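import Summits.ResolutionOfSingularities.ResolutionOfSingularities.Theorems.FrobeniusClosingPatchingRelPerfectTwoPlanesPointQIdeals
import Summits.ResolutionOfSingularities.ResolutionOfSingularities.Theorems.FrobeniusClosingPatchingRelPerfectTwoPlanesPointQModel
import Summits.ResolutionOfSingularities.ResolutionOfSingularities.Theorems.FrobeniusClosingPatchingRelPerfectTwoPlanesLevelTwo
import Summits.ResolutionOfSingularities.ResolutionOfSingularities.Theorems.FrobeniusClosingPatchingRelPerfectPolyShear
import HarnessLib

/-!
# Crux `PatchingRelPerfect` (stmt-ResolutionOfSingularities-16161), chain w52 — the rank-two member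
# `f = x₀x₁ + x₂³`: the POINT step is resolved by the plane avatar and the letter tower (level three)

[OURS · L1 W5.2 · rung, design note NEXT-two-planes-cube.md Addenda 9–12, kit j286610 / j288133]
Setting of `…TwoPlanesPointQIdeals` / `…TwoPlanesPointQModel`: `C` a regular domain with a point
family `qq = (t, p, a, b)` modelled by `q : C ↠ Λ[X_σ]` (`ker q = (t)`, `p, a, b ↦` distinct
variables).  On the chart `C_{k+1}` of `Bl_q` the companion `P_π · (h″, t)²` is the letter flag
`(w)³ · (u′, w)(u′, w g)(u′, w g)` (`map_K_succ`); here the hypotheses `H″(C_{k+1}; u′, w, g)` of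
`isRegular_of_isBlowup_letterTower` are DISCHARGED from the polynomial model of `C_{k+1}/(u′)`
(`exists_pointQ_model`: `w ↦ X_{ι k}`, `g ↦` a GRAPH `X_v + q′`) and bricks 2/7, and the four
charts are assembled:

* `notMem_span_X_of_kill_ne_zero`, `X_notMem_span_X_add_mul` — polynomial non-memberships;
* `pointQ_letterTower` — the chart `C_{k+1}` for an abstract strict transform `g` with a graph model;
* `isRegular_of_isBlowup_pointQ_succ` (`k = 0, 1, 2`: `g = e′₂ + w e′₃³`, `e′₁ + w e′₃³`, `e′₁e′₂ + w`),
  `isRegular_of_isBlowup_pointQ_zero` (chart of `t`, Cartier);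
* **`isRegular_of_isBlowup_pointQ`** — every blowing up of `Spec C` along `(P_π · (h″, t)²) · 𝔪_q`
  is regular.

Nothing here is a statement of the manuscript under review.

## References

* The Stacks Project, Tags 080A, 080B, 0804, 0BIQ. [StacksProject]
* Q. Liu, *Algebraic Geometry and Arithmetic Curves*, OUP 2002, Thm. 8.1.19 (a). [Liu2002]
* U. Görtz, T. Wedhorn, *Algebraic Geometry I*, 2nd ed. 2020, Prop. 13.96 (2). [GortzWedhorn2020]
-/

-- `Summit.<Summit>.<Sub>.Theorems` with `Sub = Summit` (single-conjunct summit, D-0017)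
set_option linter.dupNamespace false

noncomputable section

open CategoryTheory CategoryTheory.Limits AlgebraicGeometry Literature.AlgebraicGeometry.Resolution
open IsLocalRing

namespace Summit.ResolutionOfSingularities.ResolutionOfSingularities.Theorems

namespace TwoPlanesRung

open ConeRung

universe u

/-! ## Polynomial non-memberships -/

section Poly

variable {Λ : Type u} [CommRing Λ] {σ : Type}

/-- If killing the variable `X_i` does not kill `P`, then `P ∉ (X_i)`. [folklore] -/
theorem notMem_span_X_of_kill_ne_zero [DecidableEq σ] (i : σ) (P : MvPolynomial σ Λ)
    (h : MvPolynomial.aeval (fun j => if j = i then (0 : MvPolynomial σ Λ) else MvPolynomial.X j) P ≠ 0) :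
    P ∉ Ideal.span {(MvPolynomial.X i : MvPolynomial σ Λ)} := by
  intro hP
  obtain ⟨c, rfl⟩ := Ideal.mem_span_singleton'.mp hP
  apply h
  rw [map_mul, MvPolynomial.aeval_X, if_pos rfl, mul_zero]

/-- `X_v ∉ (X_v + X_i X_j)` over a domain (`v, i, j` distinct). [folklore] -/
theorem X_notMem_span_X_add_mul [IsDomain Λ] [DecidableEq σ] (v i j : σ) (hiv : i ≠ v) (hjv : j ≠ v) :
    (MvPolynomial.X v : MvPolynomial σ Λ) ∉
      Ideal.span {(MvPolynomial.X v + MvPolynomial.X i * MvPolynomial.X j : MvPolynomial σ Λ)} := by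
  have hq : v ∉ (MvPolynomial.X i * MvPolynomial.X j : MvPolynomial σ Λ).vars := by
    intro h
    rcases Finset.mem_union.mp (MvPolynomial.vars_mul _ _ h) with h1 | h1 <;>
      rw [MvPolynomial.vars_X, Finset.mem_singleton] at h1
    · exact hiv h1.symm
    · exact hjv h1.symm
  intro hX
  have hm : (MvPolynomial.X i * MvPolynomial.X j : MvPolynomial σ Λ) ∈
      Ideal.span {(MvPolynomial.X v + MvPolynomial.X i * MvPolynomial.X j : MvPolynomial σ Λ)} := by
    have := Ideal.sub_mem _ (Ideal.mem_span_singleton_self _) hX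
    rwa [add_sub_cancel_left] at this
  obtain ⟨E, hE⟩ := PolyShear.exists_quotSpanXAddEquiv v hq
  have h0 : E (Ideal.Quotient.mk _ (MvPolynomial.X i * MvPolynomial.X j)) = 0 := by
    rw [Ideal.Quotient.eq_zero_iff_mem.mpr hm, map_zero]
  rw [map_mul, map_mul, hE i hiv, hE j hjv] at h0
  exact mul_ne_zero (MvPolynomial.X_ne_zero _) (MvPolynomial.X_ne_zero _) h0

/-- The quotient by a variable is a regular domain. [folklore] -/
theorem isDomain_isRegularRing_quot_span_X [IsDomain Λ] [IsRegularRing Λ] [DecidableEq σ] [Finite σ] (v : σ) :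
    IsDomain (MvPolynomial σ Λ ⧸ Ideal.span {(MvPolynomial.X v : MvPolynomial σ Λ)}) ∧
      IsRegularRing (MvPolynomial σ Λ ⧸ Ideal.span {(MvPolynomial.X v : MvPolynomial σ Λ)}) := by
  have hq : v ∉ (0 : MvPolynomial σ Λ).vars := by rw [MvPolynomial.vars_0]; exact Finset.notMem_empty _
  have h1 := PolyShear.isDomain_quot_span_X_add v hq
  have h2 := PolyShear.isRegularRing_quot_span_X_add v hq
  rw [add_zero] at h1 h2
  exact ⟨h1, h2⟩

end Poly

/-! ## A quotient by a pair through a model of the quotient by the first element -/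

/-- If `e : R/(c) ≅ P` and `e(ȳ) = Y` then `R/(c, y) ≅ P/(Y)`. [folklore] -/
theorem nonempty_quot_pair_equiv {R P : Type*} [CommRing R] [CommRing P] (c y : R)
    (e : (R ⧸ Ideal.span {c}) ≃+* P) (Y : P) (hY : e (Ideal.Quotient.mk _ y) = Y) :
    Nonempty ((R ⧸ Ideal.span {c, y}) ≃+* P ⧸ Ideal.span {Y}) := by
  have e1 : (R ⧸ Ideal.span {c, y}) ≃+* R ⧸ (Ideal.span {c} ⊔ Ideal.span {y}) :=
    Ideal.quotEquivOfEq (Ideal.span_insert c {y})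
  have e2 : (R ⧸ (Ideal.span {c} ⊔ Ideal.span {y})) ≃+*
      (R ⧸ Ideal.span {c}) ⧸ (Ideal.span {y}).map (Ideal.Quotient.mk (Ideal.span {c})) :=
    (DoubleQuot.quotQuotEquivQuotSup _ _).symm
  have e3 : ((R ⧸ Ideal.span {c}) ⧸ (Ideal.span {y}).map (Ideal.Quotient.mk (Ideal.span {c}))) ≃+*
      P ⧸ Ideal.span {Y} :=
    Ideal.quotientEquiv _ _ e (by
      rw [Ideal.map_span, Set.image_singleton, Ideal.map_span, Set.image_singleton]
      exact congrArg (fun z => Ideal.span {z}) hY.symm)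
  exact ⟨e1.trans (e2.trans e3)⟩

section PointQ

variable {C : Type u} [CommRing C] (t p a b : C) {Λ : Type u} [CommRing Λ] {σ : Type}
  (q : C →+* MvPolynomial σ Λ) (ι : Fin 3 → σ)

local notation3 "vv" => (![p, a, b] : Fin 3 → C)
local notation3 "qq" => (Fin.cons t ![p, a, b] : Fin 4 → C)
local notation3 "MQ" => Ideal.span (Set.range (Fin.cons t ![p, a, b] : Fin 4 → C))
local notation3 "Ppi" => Ideal.span {t} ⊔ Ideal.span {p, a, b} ^ 2
local notation3 "hh" => p * a + b ^ 3
local notation3 "ψ[" i "]" => chartBase (Fin.cons t ![p, a, b] : Fin 4 → C) i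
local notation3 "w[" i "]" => chartBase (Fin.cons t ![p, a, b] : Fin 4 → C) i ((Fin.cons t ![p, a, b] : Fin 4 → C) i)
local notation3 "e[" i "," j "]" => chartGen (Fin.cons t ![p, a, b] : Fin 4 → C) i j

set_option maxHeartbeats 400000 in
/-- **The chart `C_{k+1}` for an abstract strict transform `g` with a graph model.**  If
`ψ(h″) = w² g` and under every model `Φ : C_{k+1}/(u′) ≅ Λ[X_σ]` (with the values of
`exists_pointQ_model`) the class of `g` is a polynomial `G = X_v + q′` (`v ∉ vars q′`) with
`G ∉ (X_{ι k})` and `X_{ι k} ∉ (G)`, then every blowing up of `Spec C_{k+1}` along the image of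
`P_π · (h″, t)²` is regular. [cite: StacksProject, Tag 080A] [cite: Liu2002, Thm. 8.1.19 (a)]
[cite: GortzWedhorn2020, Prop. 13.96 (2)] -/
theorem pointQ_letterTower [IsDomain C] [IsRegularRing C] [IsDomain Λ] [IsRegularRing Λ] [DecidableEq σ]
    [Finite σ] (hq : Function.Surjective q) (hker : RingHom.ker q = Ideal.span {t})
    (hι : Function.Injective ι) (hqp : q p = MvPolynomial.X (ι 0)) (hqa : q a = MvPolynomial.X (ι 1))
    (hqb : q b = MvPolynomial.X (ι 2)) (ht : t ∈ nonZeroDivisors C) (k : Fin 3)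
    (g : chartRing qq (Fin.succ k)) (hg : ψ[Fin.succ k] hh = w[Fin.succ k] ^ 2 * g)
    (G q' : MvPolynomial σ Λ) (v : σ) (hGv : G = MvPolynomial.X v + q') (hvq : v ∉ q'.vars)
    (hΦ : ∀ Φ : (chartRing qq (Fin.succ k) ⧸ Ideal.span {e[Fin.succ k, 0]}) ≃+* MvPolynomial σ Λ,
      (∀ r : C, Φ (Ideal.Quotient.mk _ (ψ[Fin.succ k] r)) = coordBlowupSubst Λ (Set.range ι) (ι k) (q r)) →
      (∀ j : Fin 3, j ≠ k → Φ (Ideal.Quotient.mk _ (e[Fin.succ k, Fin.succ j])) = MvPolynomial.X (ι j)) →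
      Φ (Ideal.Quotient.mk _ g) = G)
    (hGk : G ∉ Ideal.span {(MvPolynomial.X (ι k) : MvPolynomial σ Λ)})
    (hkG : (MvPolynomial.X (ι k) : MvPolynomial σ Λ) ∉ Ideal.span {G})
    {Y : Scheme.{u}} {ρ : Y ⟶ Spec (.of (chartRing qq (Fin.succ k)))}
    (hρ : IsBlowup ρ (affineBlowup.idealSheaf ((Ppi * Ideal.span {hh, t} ^ 2).map ψ[Fin.succ k]))) :
    Scheme.IsRegular Y := by
  have hqq := isQuasiRegular_qq t p a b q ι hq hker hι hqp hqa hqb ht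
  haveI : IsDomain (C ⧸ MQ) := isDomain_quot_MQ t p a b q ι hq hker hqp hqa hqb
  haveI : IsRegularRing (C ⧸ MQ) := isRegularRing_quot_MQ t p a b q ι hq hker hqp hqa hqb
  haveI : IsDomain (C ⧸ Ideal.span {t}) := isDomain_quot_t t q hq hker
  haveI : IsRegularRing (chartRing qq (Fin.succ k)) := isRegularRing_blowupChart qq (Fin.succ k) hqq
  have hvk : vv k ∉ Ideal.span {t} := cons_notMem_span_t t p a b q ι hker hqp hqa hqb k
  have hvk' : qq (Fin.succ k) ∉ Ideal.span {t} := by rw [Fin.cons_succ]; exact hvk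
  have hvk0 : qq (Fin.succ k) ≠ 0 := fun h => hvk' (h ▸ Ideal.zero_mem _)
  haveI : IsDomain (chartRing qq (Fin.succ k)) := strictExc_isDomain_chart t vv k hvk0
  have hprime : (Ideal.span {t}).IsPrime := (Ideal.Quotient.isDomain_iff_prime _).mp inferInstance
  -- the two strict-transform factorisations feeding bricks 2/7
  have hw2 : ψ[Fin.succ k] (qq (Fin.succ k) ^ 2) = w[Fin.succ k] ^ 1 * w[Fin.succ k] := by
    rw [map_pow, pow_one, sq]
  have hr2 : qq (Fin.succ k) ^ 2 ∉ Ideal.span {t} := fun h =>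
    hvk' ((hprime.mem_or_mem (sq (qq (Fin.succ k)) ▸ h)).elim id id)
  have hhh : hh ∉ Ideal.span {t} := hh_notMem_span_t t p a b q ι hker hι hqp hqa hqb
  have hWw := strictExc_isWeaklyRegular_pair t vv k hqq hvk hw2 hr2
  have hWg := strictExc_isWeaklyRegular_pair t vv k hqq hvk hg hhh
  -- the model
  obtain ⟨Φ, hΦr, hΦe⟩ := exists_pointQ_model t p a b q ι hq hker hι hqp hqa hqb hqq k
  have hΦw : Φ (Ideal.Quotient.mk _ w[Fin.succ k]) = MvPolynomial.X (ι k) := by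
    rw [hΦr, Fin.cons_succ, q_cons p a b q ι hqp hqa hqb, coordBlowupSubst_X_self]
  have hΦg : Φ (Ideal.Quotient.mk _ g) = G := hΦ Φ hΦr hΦe
  obtain ⟨eW⟩ := nonempty_quot_pair_equiv _ _ Φ _ hΦw
  obtain ⟨eG⟩ := nonempty_quot_pair_equiv _ _ Φ _ hΦg
  obtain ⟨hdX, hrX⟩ := isDomain_isRegularRing_quot_span_X (Λ := Λ) (σ := σ) (ι k)
  haveI : IsDomain (MvPolynomial σ Λ ⧸ Ideal.span {G}) := by
    rw [hGv]; exact PolyShear.isDomain_quot_span_X_add v hvq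
  haveI : IsRegularRing (MvPolynomial σ Λ ⧸ Ideal.span {G}) := by
    rw [hGv]; exact PolyShear.isRegularRing_quot_span_X_add v hvq
  -- non-memberships through the model
  have hu0 : Φ (Ideal.Quotient.mk _ e[Fin.succ k, 0]) = 0 := by
    rw [Ideal.Quotient.eq_zero_iff_mem.mpr (Ideal.mem_span_singleton_self _), map_zero]
  have hgw : g ∉ Ideal.span {e[Fin.succ k, 0], w[Fin.succ k]} := by
    intro h
    obtain ⟨α, β, hαβ⟩ := Ideal.mem_span_pair.mp h
    apply hGk
    have h1 := congrArg (fun z => Φ (Ideal.Quotient.mk (Ideal.span {e[Fin.succ k, 0]}) z)) hαβ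
    simp only [map_add, map_mul, hu0, mul_zero, zero_add, hΦg, hΦw] at h1
    rw [← h1]
    exact Ideal.mul_mem_left _ _ (Ideal.mem_span_singleton_self _)
  have hwg : w[Fin.succ k] ∉ Ideal.span {e[Fin.succ k, 0], g} := by
    intro h
    obtain ⟨α, β, hαβ⟩ := Ideal.mem_span_pair.mp h
    apply hkG
    have h1 := congrArg (fun z => Φ (Ideal.Quotient.mk (Ideal.span {e[Fin.succ k, 0]}) z)) hαβ
    simp only [map_add, map_mul, hu0, mul_zero, zero_add, hΦg, hΦw] at h1
    rw [← h1]
    exact Ideal.mul_mem_left _ _ (Ideal.mem_span_singleton_self _)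
  -- the flag and the tower
  rw [map_K_succ t p a b k g hg] at hρ
  exact CoreRungTower.isRegular_of_isBlowup_span_singleton_mul
    (pow_mem (reesChartBase_mem_nonZeroDivisors (qq (Fin.succ k))
      (Ideal.mem_span_range_self (f := qq) (x := Fin.succ k))) 3) _
    (fun Y' ρ' h' => isRegular_of_isBlowup_letterTower 3 e[Fin.succ k, 0] w[Fin.succ k] g
      (fun r => [w[Fin.succ k], g, 1].getD r 1) (tp_letters_wg _ _)
      (isQuasiRegular_of_isWeaklyRegular _ hWw) (isQuasiRegular_of_isWeaklyRegular _ hWg)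
      (MulEquiv.isDomain _ eW.toMulEquiv) (IsRegularRing.of_ringEquiv eW.symm)
      (MulEquiv.isDomain _ eG.toMulEquiv) (IsRegularRing.of_ringEquiv eG.symm)
      ((isWeaklyRegular_pair_iff _ _).mp hWw).2 ((isWeaklyRegular_pair_iff _ _).mp hWg).2
      (nonZeroDivisors.ne_zero (reesChartBase_mem_nonZeroDivisors (qq (Fin.succ k))
        (Ideal.mem_span_range_self (f := qq) (x := Fin.succ k)))) hgw hwg h') hρ

/-- `v` is not a variable of `X_i X_j ^ n` when `v ≠ i, j`. [folklore] -/
theorem notMem_vars_X_mul_X_pow [Nontrivial Λ] [DecidableEq σ] (v i j : σ) (n : ℕ) (hiv : i ≠ v) (hjv : j ≠ v) :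
    v ∉ (MvPolynomial.X i * MvPolynomial.X j ^ n : MvPolynomial σ Λ).vars := by
  intro h
  rcases Finset.mem_union.mp (MvPolynomial.vars_mul _ _ h) with h1 | h1
  · rw [MvPolynomial.vars_X, Finset.mem_singleton] at h1; exact hiv h1.symm
  · have h2 := MvPolynomial.vars_pow _ _ h1
    rw [MvPolynomial.vars_X, Finset.mem_singleton] at h2; exact hjv h2.symm

/-- **The chart of `p` (`k = 0`) is resolved**: `g = e′₂ + w e′₃³ ↦ X_{ι1} + X_{ι0} X_{ι2}³`.
[cite: StacksProject, Tag 080A] [cite: Liu2002, Thm. 8.1.19 (a)] [cite: GortzWedhorn2020, Prop. 13.96 (2)] -/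
theorem isRegular_of_isBlowup_pointQ_p [IsDomain C] [IsRegularRing C] [IsDomain Λ] [IsRegularRing Λ]
    [DecidableEq σ] [Finite σ] (hq : Function.Surjective q) (hker : RingHom.ker q = Ideal.span {t})
    (hι : Function.Injective ι) (hqp : q p = MvPolynomial.X (ι 0)) (hqa : q a = MvPolynomial.X (ι 1))
    (hqb : q b = MvPolynomial.X (ι 2)) (ht : t ∈ nonZeroDivisors C)
    {Y : Scheme.{u}} {ρ : Y ⟶ Spec (.of (chartRing qq (Fin.succ 0)))}
    (hρ : IsBlowup ρ (affineBlowup.idealSheaf ((Ppi * Ideal.span {hh, t} ^ 2).map ψ[Fin.succ 0]))) :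
    Scheme.IsRegular Y := by
  have h01 : ι 0 ≠ ι 1 := hι.ne (by decide)
  have h12 : ι 1 ≠ ι 2 := hι.ne (by decide)
  have hg : ψ[Fin.succ 0] hh = w[Fin.succ 0] ^ 2 * (e[Fin.succ 0, 2] + w[Fin.succ 0] * e[Fin.succ 0, 3] ^ 3) :=
    chartBase_hh_one t p a b
  refine pointQ_letterTower t p a b q ι hq hker hι hqp hqa hqb ht 0 _ hg
    (MvPolynomial.X (ι 1) + MvPolynomial.X (ι 0) * MvPolynomial.X (ι 2) ^ 3)
    (MvPolynomial.X (ι 0) * MvPolynomial.X (ι 2) ^ 3) (ι 1) rfl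
    (notMem_vars_X_mul_X_pow _ _ _ 3 h01 h12.symm) (fun Φ hΦr hΦe => ?_) ?_ ?_ hρ
  · have hw : Φ (Ideal.Quotient.mk _ w[Fin.succ 0]) = MvPolynomial.X (ι 0) := by
      rw [hΦr, Fin.cons_succ, q_cons p a b q ι hqp hqa hqb, coordBlowupSubst_X_self]
    have h2 : Φ (Ideal.Quotient.mk _ e[Fin.succ 0, 2]) = MvPolynomial.X (ι 1) := hΦe 1 (by decide)
    have h3 : Φ (Ideal.Quotient.mk _ e[Fin.succ 0, 3]) = MvPolynomial.X (ι 2) := hΦe 2 (by decide)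
    simp only [map_add, map_mul, map_pow, hw, h2, h3]
  · refine notMem_span_X_of_kill_ne_zero (ι 0) _ ?_
    rw [map_add, map_mul, map_pow, MvPolynomial.aeval_X, MvPolynomial.aeval_X, MvPolynomial.aeval_X,
      if_neg h01.symm, if_pos rfl, zero_mul, add_zero]
    exact MvPolynomial.X_ne_zero _
  · exact PolyShear.X_notMem_span_X_add (ι 1) (notMem_vars_X_mul_X_pow _ _ _ 3 h01 h12.symm) h01

/-- **The chart of `a` (`k = 1`) is resolved**: `g = e′₁ + w e′₃³ ↦ X_{ι0} + X_{ι1} X_{ι2}³`.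
[cite: StacksProject, Tag 080A] [cite: Liu2002, Thm. 8.1.19 (a)] [cite: GortzWedhorn2020, Prop. 13.96 (2)] -/
theorem isRegular_of_isBlowup_pointQ_a [IsDomain C] [IsRegularRing C] [IsDomain Λ] [IsRegularRing Λ]
    [DecidableEq σ] [Finite σ] (hq : Function.Surjective q) (hker : RingHom.ker q = Ideal.span {t})
    (hι : Function.Injective ι) (hqp : q p = MvPolynomial.X (ι 0)) (hqa : q a = MvPolynomial.X (ι 1))
    (hqb : q b = MvPolynomial.X (ι 2)) (ht : t ∈ nonZeroDivisors C)
    {Y : Scheme.{u}} {ρ : Y ⟶ Spec (.of (chartRing qq (Fin.succ 1)))}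
    (hρ : IsBlowup ρ (affineBlowup.idealSheaf ((Ppi * Ideal.span {hh, t} ^ 2).map ψ[Fin.succ 1]))) :
    Scheme.IsRegular Y := by
  have h01 : ι 0 ≠ ι 1 := hι.ne (by decide)
  have h02 : ι 0 ≠ ι 2 := hι.ne (by decide)
  have hg : ψ[Fin.succ 1] hh = w[Fin.succ 1] ^ 2 * (e[Fin.succ 1, 1] + w[Fin.succ 1] * e[Fin.succ 1, 3] ^ 3) :=
    chartBase_hh_two t p a b
  refine pointQ_letterTower t p a b q ι hq hker hι hqp hqa hqb ht 1 _ hg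
    (MvPolynomial.X (ι 0) + MvPolynomial.X (ι 1) * MvPolynomial.X (ι 2) ^ 3)
    (MvPolynomial.X (ι 1) * MvPolynomial.X (ι 2) ^ 3) (ι 0) rfl
    (notMem_vars_X_mul_X_pow _ _ _ 3 h01.symm h02.symm) (fun Φ hΦr hΦe => ?_) ?_ ?_ hρ
  · have hw : Φ (Ideal.Quotient.mk _ w[Fin.succ 1]) = MvPolynomial.X (ι 1) := by
      rw [hΦr, Fin.cons_succ, q_cons p a b q ι hqp hqa hqb, coordBlowupSubst_X_self]
    have h1 : Φ (Ideal.Quotient.mk _ e[Fin.succ 1, 1]) = MvPolynomial.X (ι 0) := hΦe 0 (by decide)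
    have h3 : Φ (Ideal.Quotient.mk _ e[Fin.succ 1, 3]) = MvPolynomial.X (ι 2) := hΦe 2 (by decide)
    simp only [map_add, map_mul, map_pow, hw, h1, h3]
  · refine notMem_span_X_of_kill_ne_zero (ι 1) _ ?_
    rw [map_add, map_mul, map_pow, MvPolynomial.aeval_X, MvPolynomial.aeval_X, MvPolynomial.aeval_X,
      if_neg h01, if_pos rfl, zero_mul, add_zero]
    exact MvPolynomial.X_ne_zero _
  · exact PolyShear.X_notMem_span_X_add (ι 0) (notMem_vars_X_mul_X_pow _ _ _ 3 h01.symm h02.symm) h01.symm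

/-- **The chart of `b` (`k = 2`) is resolved**: `g = e′₁ e′₂ + w ↦ X_{ι2} + X_{ι0} X_{ι1}`.
[cite: StacksProject, Tag 080A] [cite: Liu2002, Thm. 8.1.19 (a)] [cite: GortzWedhorn2020, Prop. 13.96 (2)] -/
theorem isRegular_of_isBlowup_pointQ_b [IsDomain C] [IsRegularRing C] [IsDomain Λ] [IsRegularRing Λ]
    [DecidableEq σ] [Finite σ] (hq : Function.Surjective q) (hker : RingHom.ker q = Ideal.span {t})
    (hι : Function.Injective ι) (hqp : q p = MvPolynomial.X (ι 0)) (hqa : q a = MvPolynomial.X (ι 1))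
    (hqb : q b = MvPolynomial.X (ι 2)) (ht : t ∈ nonZeroDivisors C)
    {Y : Scheme.{u}} {ρ : Y ⟶ Spec (.of (chartRing qq (Fin.succ 2)))}
    (hρ : IsBlowup ρ (affineBlowup.idealSheaf ((Ppi * Ideal.span {hh, t} ^ 2).map ψ[Fin.succ 2]))) :
    Scheme.IsRegular Y := by
  have h02 : ι 0 ≠ ι 2 := hι.ne (by decide)
  have h12 : ι 1 ≠ ι 2 := hι.ne (by decide)
  have hg : ψ[Fin.succ 2] hh = w[Fin.succ 2] ^ 2 * (e[Fin.succ 2, 1] * e[Fin.succ 2, 2] + w[Fin.succ 2]) :=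
    chartBase_hh_three t p a b
  have hv : ι 2 ∉ (MvPolynomial.X (ι 0) * MvPolynomial.X (ι 1) : MvPolynomial σ Λ).vars := by
    have h := notMem_vars_X_mul_X_pow (Λ := Λ) (ι 2) (ι 0) (ι 1) 1 h02 h12
    rwa [pow_one] at h
  refine pointQ_letterTower t p a b q ι hq hker hι hqp hqa hqb ht 2 _ hg
    (MvPolynomial.X (ι 2) + MvPolynomial.X (ι 0) * MvPolynomial.X (ι 1))
    (MvPolynomial.X (ι 0) * MvPolynomial.X (ι 1)) (ι 2) rfl hv (fun Φ hΦr hΦe => ?_) ?_ ?_ hρ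
  · have hw : Φ (Ideal.Quotient.mk _ w[Fin.succ 2]) = MvPolynomial.X (ι 2) := by
      rw [hΦr, Fin.cons_succ, q_cons p a b q ι hqp hqa hqb, coordBlowupSubst_X_self]
    have h1 : Φ (Ideal.Quotient.mk _ e[Fin.succ 2, 1]) = MvPolynomial.X (ι 0) := hΦe 0 (by decide)
    have h2 : Φ (Ideal.Quotient.mk _ e[Fin.succ 2, 2]) = MvPolynomial.X (ι 1) := hΦe 1 (by decide)
    simp only [map_add, map_mul, hw, h1, h2]
    exact add_comm _ _
  · refine notMem_span_X_of_kill_ne_zero (ι 2) _ ?_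
    rw [map_add, map_mul, MvPolynomial.aeval_X, MvPolynomial.aeval_X, MvPolynomial.aeval_X,
      if_pos rfl, if_neg h02, if_neg h12, zero_add]
    exact mul_ne_zero (MvPolynomial.X_ne_zero _) (MvPolynomial.X_ne_zero _)
  · exact X_notMem_span_X_add_mul (ι 2) (ι 0) (ι 1) h02 h12

/-- **The chart of `t`**: the companion is the Cartier divisor `(w³)`. [cite: StacksProject, Tag 080B] -/
theorem isRegular_of_isBlowup_pointQ_zero [IsRegularRing C] (hreg : IsRegularRing (C ⧸ MQ)) (hqq : IsQuasiRegular qq)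
    {Y : Scheme.{u}} {ρ : Y ⟶ Spec (.of (chartRing qq 0))}
    (hρ : IsBlowup ρ (affineBlowup.idealSheaf ((Ppi * Ideal.span {hh, t} ^ 2).map ψ[0]))) :
    Scheme.IsRegular Y := by
  haveI := hreg
  haveI : IsRegularRing (chartRing qq 0) := isRegularRing_blowupChart qq 0 hqq
  rw [map_K_zero] at hρ
  exact isRegular_of_isBlowup_idealSheaf_span_singleton_of_isRegularRing
    (pow_mem (reesChartBase_mem_nonZeroDivisors (qq 0) (Ideal.mem_span_range_self (f := qq) (x := 0))) 3) hρ

/-- **THE POINT STEP IS RESOLVED**: every blowing up of `Spec C` along `(P_π · (h″, t)²) · 𝔪_q` is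
regular. [cite: StacksProject, Tag 080A] [cite: Liu2002, Thm. 8.1.19 (a)]
[cite: GortzWedhorn2020, Prop. 13.96 (2)] -/
theorem isRegular_of_isBlowup_pointQ [IsDomain C] [IsRegularRing C] [IsDomain Λ] [IsRegularRing Λ]
    [DecidableEq σ] [Finite σ] (hq : Function.Surjective q) (hker : RingHom.ker q = Ideal.span {t})
    (hι : Function.Injective ι) (hqp : q p = MvPolynomial.X (ι 0)) (hqa : q a = MvPolynomial.X (ι 1))
    (hqb : q b = MvPolynomial.X (ι 2)) (ht : t ∈ nonZeroDivisors C)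
    {Y : Scheme.{u}} {ρ : Y ⟶ Spec (.of C)}
    (hρ : IsBlowup ρ (affineBlowup.idealSheaf ((Ppi * Ideal.span {hh, t} ^ 2) * MQ))) :
    Scheme.IsRegular Y := by
  have hqq := isQuasiRegular_qq t p a b q ι hq hker hι hqp hqa hqb ht
  have hreg : IsRegularRing (C ⧸ MQ) := isRegularRing_quot_MQ t p a b q ι hq hker hqp hqa hqb
  have h0 : ∀ (Y' : Scheme.{u}) (ρ' : Y' ⟶ Spec (.of (chartRing qq 0))),
      IsBlowup ρ' (affineBlowup.idealSheaf ((Ppi * Ideal.span {hh, t} ^ 2).map ψ[0])) → Scheme.IsRegular Y' :=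
    fun Y' ρ' h' => isRegular_of_isBlowup_pointQ_zero t p a b hreg hqq h'
  have h1 : ∀ (Y' : Scheme.{u}) (ρ' : Y' ⟶ Spec (.of (chartRing qq (Fin.succ 0)))),
      IsBlowup ρ' (affineBlowup.idealSheaf ((Ppi * Ideal.span {hh, t} ^ 2).map ψ[Fin.succ 0])) →
        Scheme.IsRegular Y' :=
    fun Y' ρ' h' => isRegular_of_isBlowup_pointQ_p t p a b q ι hq hker hι hqp hqa hqb ht h'
  have h2 : ∀ (Y' : Scheme.{u}) (ρ' : Y' ⟶ Spec (.of (chartRing qq (Fin.succ 1)))),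
      IsBlowup ρ' (affineBlowup.idealSheaf ((Ppi * Ideal.span {hh, t} ^ 2).map ψ[Fin.succ 1])) →
        Scheme.IsRegular Y' :=
    fun Y' ρ' h' => isRegular_of_isBlowup_pointQ_a t p a b q ι hq hker hι hqp hqa hqb ht h'
  have h3 : ∀ (Y' : Scheme.{u}) (ρ' : Y' ⟶ Spec (.of (chartRing qq (Fin.succ 2)))),
      IsBlowup ρ' (affineBlowup.idealSheaf ((Ppi * Ideal.span {hh, t} ^ 2).map ψ[Fin.succ 2])) →
        Scheme.IsRegular Y' :=
    fun Y' ρ' h' => isRegular_of_isBlowup_pointQ_b t p a b q ι hq hker hι hqp hqa hqb ht h'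
  have hsucc : ∀ (k : Fin 3) (Y' : Scheme.{u}) (ρ' : Y' ⟶ Spec (.of (chartRing qq (Fin.succ k)))),
      IsBlowup ρ' (affineBlowup.idealSheaf ((Ppi * Ideal.span {hh, t} ^ 2).map ψ[Fin.succ k])) →
        Scheme.IsRegular Y' :=
    Fin.forall_fin_succ.mpr ⟨h1, Fin.forall_fin_succ.mpr ⟨h2, Fin.forall_fin_succ.mpr ⟨h3, fun k => k.elim0⟩⟩⟩
  exact isRegular_of_isBlowup_mul_of_charts qq (Ppi * Ideal.span {hh, t} ^ 2)
    (Fin.forall_fin_succ.mpr ⟨h0, hsucc⟩) hρ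

end PointQ

end TwoPlanesRung

end Summit.ResolutionOfSingularities.ResolutionOfSingularities.Theorems

end
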